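import Literature.NumberTheory.EllipticCurves.CasselsTateLevelAssembly
import Literature.NumberTheory.EllipticCurves.LocalUnramifiedTwoCocycle
import Literature.NumberTheory.EllipticCurves.NeronOggShafarevichLocal
import Literature.NumberTheory.EllipticCurves.SelmerFiniteProofs
import Literature.NumberTheory.GaloisRepresentations.LocalGlobalCohomologyProofs
import Literature.NumberTheory.DiophantineGeometry.LocalReductionFiniteBadPlacesProofs
import HarnessLib

/-!
# The local terms of the Cassels–Tate pairing have finite support

Topic `NumberTheory/EllipticCurves`; namespace `Literature.NumberTheory.EllipticCurves`. Theorems only: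
**no definition and no named fact is introduced** (D-0026).

This file DISCHARGES the hypothesis `hfin` of the tree's assembly of the Cassels–Tate pairing at
level `m` (`CasselsTateLevelAssembly.isLevelPairing_ctLevelPairing`): for every general-case datum
`D` of Milne's construction (`CasselsTateGeneralCase.GeneralCaseData`: the global cochains
`β, β₁, f, β', ε` and local Kummer cocycles `κ_v`) and EVERY family `inv` of additive maps
`H²(K_v, μ_{m²}) → ℤ/m²`, the local terms `t_v = inv_v [z_v]`, `z_v = ι⁻¹(β_{1,v} - κ_v) ∪ β'_v - ε_v`,
vanish for all `v` outside a finite set of places (`GeneralCaseData.exists_finset_forall_localTerm_eq_zero`).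
Milne (*ADT*, I, proof of Prop. 6.9, p. 79) works with cochains of `G_S` for a finite set `S`
containing the bad places and those dividing `m`, so that his sum is over `v ∈ S`; in the tree the
cochains are continuous cochains of `Γ_K`, and the finiteness is PROVED here, as follows.

1. (*uniform local constancy*, `exists_nhds_one_forall_eq`, `GeneralCaseData.exists_openNormalSubgroup`)
   The finitely many global cochains `β₁, β', ε` (continuous, discrete values, `Γ_K` compact) and the
   action of `Γ_K` on the finite module `μ_{m²}` are right-invariant under `Gal(K̄/E)` for ONE finite
   Galois extension `E/K` (tube lemma + Krull topology).
2. (*unramified almost everywhere*, `exists_openNormalSubgroup_subset`) For all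
   but finitely many finite `v`, the local inertia group `I_𝔐 ≤ Γ_{K_v}` restricts into `Gal(K̄/E)`
   (tree: `resGalOfEmb_mem_inertia_primeBelow`, `eventually_forall_inertia_mem_fixingSubgroup`).
3. (*unramified Kummer lifts*, `exists_kummerLift_unramified`) At a place of good reduction `v ∤ m`
   where `β_v` is unramified, the local Kummer lift `κ_v = κ_{Q₁}` (`[m]Q₁ = Q`, `β_v = κ_Q`) can be
   taken unramified: inertia fixes `Q` hence `Q₁` (the tree's reduction step
   `smul_localPoints_eq_of_mem_inertia_holds`, Silverman X.4.2(b)); the local term does not depend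
   on the lift (`GeneralLocalData.term_eq_of_kummer`).
4. (*vanishing*, `GeneralLocalData.term_eq_zero_of_unramified`) With these choices `z_v` is a continuous
   `2`-cocycle of `Γ_{K_v}` with values in `μ_{m²}`, right-invariant under an open subgroup containing
   `I_𝔐` which acts trivially; such a class vanishes (`twoCocycleClass_eq_zero_of_inertia_le`, the
   tree's cochain form of `H²(K_v^{nr}/K_v, μ) = 0`), so `t_v = inv_v 0 = 0` — for ANY additive `inv_v`.
5. The infinite places, the bad places (finite: `finite_badPlaces_holds`), the places dividing `m` and the
   exceptions of step 2 form the finite exceptional set.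

Consequently the level-`m` assembly holds WITHOUT the hypothesis `hfin`
(`isLevelPairing_ctLevelPairing_of_inputs`, `exists_isLevelPairing_of_inputs`): the remaining inputs of
the Cassels–Tate fact `WeierstrassCurve.exists_casselsTate_pairing` at level `m` are `halt` (Weil pairing
alternating — the tree has it), the reciprocity `hPT'` for `H²(K, μ_{m²})`, `hH3` (`Ш³(K, μ_{m²}) = 0`),
the Poitou–Tate input `hPTc` for `Ш²(K, E[m])`, the Lemma-6.15 input `h615`, and the alternation
`hct_alt` (proved in the tree at odd `m`, `CasselsTateSelfPairing`); and the fact itself follows from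
these inputs at all prime-power levels (`exists_casselsTate_pairing_of_inputs`, §7: the Weil pairing from
`exists_weilPairing_holds`, the levels from `WeierstrassCurve.exists_casselsTate_pairing_of_levelwise`).

## References

* [MilneADT2006] J. S. Milne, *Arithmetic Duality Theorems*, 2nd ed. (2006), Ch. I §6, proof of
  Prop. 6.9 (p. 79: the cochains are `G_S`-cochains, the pairing is `∑_{v∈S}`), Lemma 4.8 (classes
  are unramified almost everywhere), Ch. I §2 (`G/I ≅ Ẑ`).
* [SilvermanAEC2009] J. H. Silverman, *The Arithmetic of Elliptic Curves*, 2nd ed. (2009), X.§4,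
  proof of Thm. 4.2(b) and Cor. 4.4 (Selmer classes are unramified outside `S`), VIII.§2, Thm. X.4.14.
* [NeukirchANT1999] J. Neukirch, *Algebraic Number Theory* (1999), Ch. II §9 (9.6) (local and global
  inertia), Ch. III §2 (2.6) (finitely many ramified places).

## Design

`noncomputable section`, `open scoped Classical`, one universe `u`; the local steps 3–4 are stated over
`v.adicCompletion K` (the type of the tree's local objects `localPrimesAbove`, `Ideal.inertia`) and
specialised to the datum `D.localData (Sum.inr v)` over `Place.Completion (Sum.inr v)` (definitionally
the same field) only in the final step; compactness of absolute Galois groups and `char K_v = 0` are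
local instances, as in the sibling files.
-/

noncomputable section

open scoped Classical Topology

universe u

namespace Literature.NumberTheory.EllipticCurves

open CategoryTheory _root_.WeierstrassCurve Field Function NumberField IsDedekindDomain
open Literature.NumberTheory.GaloisRepresentations Literature.NumberTheory.GaloisCohomology
open Literature.NumberTheory.GaloisRepresentations.DiscreteGaloisModule (mu MuCarrier pairing)
open IsDedekindDomain.HeightOneSpectrum
open Literature.GroupTheory.FiniteAbelian
open scoped ContRepresentation

-- Cup products need `LocallyCompactSpace Γ`; as in the tree's cup-product files, the compactness of
-- absolute Galois groups is a local instance only.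
attribute [local instance] absoluteGaloisGroup_compactSpace

-- `char K_v = 0` for the completions of a number field (the tree's theorem `charZero_placeCompletion`;
-- local instance, no override).
attribute [local instance] charZero_placeCompletion

/-! ## 1. Uniform local constancy of continuous cochains with discrete values -/

/-- **Uniform local constancy** (tube lemma): for a compact space `X`, a topological group `G` and a
jointly continuous `f : X × G → M` into a DISCRETE space, there is a neighbourhood `V` of `1` in `G`
with `f(x, u) = f(x, 1)` for all `x ∈ X`, `u ∈ V`.  (Applied with `X = Γ`, `f(σ, u) = c(σu)` this says
that a continuous cochain of a compact group with discrete values is right-invariant under a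
neighbourhood of `1`, uniformly.) [folklore] -/
theorem exists_nhds_one_forall_eq {X G M : Type*} [TopologicalSpace X] [CompactSpace X] [Group G]
    [TopologicalSpace G] [TopologicalSpace M] [DiscreteTopology M] (f : X → G → M)
    (hf : Continuous (Function.uncurry f)) :
    ∃ V ∈ 𝓝 (1 : G), ∀ x : X, ∀ u ∈ V, f x u = f x 1 := by
  set T : Set (X × G) := {p | f p.1 p.2 = f p.1 1} with hT
  have hTopen : IsOpen T := by
    have h1 : Continuous fun p : X × G => (f p.1 p.2, f p.1 1) :=
      hf.prodMk (hf.comp (continuous_fst.prodMk continuous_const))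
    exact (isOpen_discrete (Set.diagonal M)).preimage h1
  obtain ⟨u, w, -, hw, huniv, h1w, huw⟩ :=
    generalized_tube_lemma (isCompact_univ (X := X)) (isCompact_singleton (x := (1 : G))) hTopen
      (fun p hp => by
        obtain ⟨-, hp2⟩ := hp
        rw [Set.mem_singleton_iff] at hp2
        show f p.1 p.2 = f p.1 1
        rw [hp2])
  exact ⟨w, hw.mem_nhds (h1w rfl), fun x u' hu' =>
    show (x, u') ∈ T from huw (Set.mk_mem_prod (huniv (Set.mem_univ x)) hu')⟩

/-! ## 2. Open normal subgroups of `Γ_K` and local inertia at almost all places -/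

/-- **Krull + unramified almost everywhere.**  A neighbourhood `V` of `1` in `Γ_K` (`K` a number field)
contains an OPEN NORMAL subgroup `U = Gal(K̄/E)`, `E/K` a finite Galois subextension of `K̄`
(`krullTopology_mem_nhds_one_iff_of_normal`), and for all but finitely many finite places `v` of `K` the
local inertia group `I_𝔐 ≤ Γ_{K_v}` (for every prime `𝔐` of `\bar 𝓞_v` above `𝓂_v`) restricts into `U`
along `absGaloisRestrict K K_v` (the tree's chosen embedding `K̄ → K̄_v`): the restriction maps `I_𝔐` into
the inertia group of the prime `𝔓_{ι,𝔐}` of `\bar ℤ_K` cut out by the embedding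
(`resGalOfEmb_mem_inertia_primeBelow`, Neukirch II (9.6)), a prime above `v`, and all inertia groups
above `v` fix `E` for almost all `v` (`eventually_forall_inertia_mem_fixingSubgroup`, Neukirch III (2.6)).
[cite: NeukirchANT1999, Ch. II §9 Prop. (9.6) and Ch. III §2 Thm. (2.6)] -/
theorem exists_openNormalSubgroup_subset {K : Type u} [Field K] [NumberField K]
    {V : Set (absoluteGaloisGroup K)} (hV : V ∈ 𝓝 (1 : absoluteGaloisGroup K)) :
    ∃ U : Subgroup (absoluteGaloisGroup K), U.Normal ∧ IsOpen (U : Set (absoluteGaloisGroup K)) ∧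
      (U : Set (absoluteGaloisGroup K)) ⊆ V ∧
      ∀ᶠ v : HeightOneSpectrum (𝓞 K) in Filter.cofinite, ∀ 𝔐 ∈ v.localPrimesAbove,
        ∀ σ ∈ 𝔐.inertia (absoluteGaloisGroup (v.adicCompletion K)),
          absGaloisRestrict K (v.adicCompletion K) σ ∈ U := by
  obtain ⟨E, hfin, hnorm, hEV⟩ := (krullTopology_mem_nhds_one_iff_of_normal K (AlgebraicClosure K) _).1 hV
  haveI := hfin
  haveI := hnorm
  haveI : IsGalois K E := IsGalois.mk
  let U : Subgroup (absoluteGaloisGroup K) :=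
    (E.fixingSubgroup).comap (absoluteGaloisGroup.toAlgEquiv K).toMonoidHom
  have hUmem : ∀ σ : absoluteGaloisGroup K, σ ∈ U ↔ absoluteGaloisGroup.toAlgEquiv K σ ∈ E.fixingSubgroup :=
    fun σ => Subgroup.mem_comap
  refine ⟨U, Subgroup.Normal.comap inferInstance _, ?_, fun σ hσ => hEV hσ, ?_⟩
  · exact Subgroup.isOpen_of_mem_nhds U (g := 1)
      ((krullTopology_mem_nhds_one_iff_of_normal K (AlgebraicClosure K) _).2 ⟨E, hfin, hnorm, fun σ hσ => hσ⟩)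
  · filter_upwards [eventually_forall_inertia_mem_fixingSubgroup (F := K) E] with v hv
    intro 𝔐 h𝔐 σ hσ
    rw [hUmem, ← resGal_eq_absGaloisRestrict, resGal_eq]
    exact hv _ (primeBelow_mem_primesAbove (ι := closureEmb (K := K) (v.adicCompletion K)) h𝔐) _
      (resGalOfEmb_mem_inertia_primeBelow v (closureEmb (K := K) (v.adicCompletion K)) 𝔐 hσ)

/-! ## 3. Unramified local Kummer lifts at good places -/

section KummerLift

variable {K : Type u} [Field K] [NumberField K] (W : WeierstrassCurve K) (m : ℕ) [NeZero m]

/-- **Unramified local Kummer lifts.**  Let `v` be a finite place of good reduction with `v ∤ m`, `𝔐`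
the prime of `\bar 𝓞_v` above `𝓂_v` and `I = I_𝔐 ≤ Γ_{K_v}`.  Let `ψ : Γ_{K_v} → E[m](K̄)` be a
continuous cocycle whose class satisfies the local Kummer condition and which VANISHES ON `I`.  Then
there is a local Kummer cocycle `κ : Γ_{K_v} → E[m²](K̄)` (class in `𝓛_v^{(m²)}`) with `[m] ∘ κ = ψ`
exactly, which is right-invariant under an OPEN subgroup `T ⊇ I` of `Γ_{K_v}`.  Proof: `ψ = κ_Q` on the
nose for a point `Q ∈ E(K̄_v)` with `mQ ∈ E(K_v)` (`exists_localKummerCocycle_eq`); `ψ|_I = 0` says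
that `I` fixes `Q`; for `Q₁` with `mQ₁ = Q` and `i ∈ I`, `m(iQ₁ - Q₁) = iQ - Q = O`, so `iQ₁ = Q₁` by
the reduction step of Silverman's proof of X.4.2(b) (the tree's `smul_localPoints_eq_of_mem_inertia_holds`:
`E[m]` injects into `Ẽ_v(k̄_v)` on which inertia acts trivially); take `κ = κ_{Q₁}` and `T` the
stabiliser of `Q₁` (open, `isOpen_stabilizer_localPoints`). [cite: SilvermanAEC2009, X.§4 proof of Thm. 4.2(b) and VIII.§2] -/
theorem exists_kummerLift_unramified [W.IsElliptic] (v : HeightOneSpectrum (𝓞 K))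
    (hv : v ∉ W.badPlaces (𝓞 K)) (hmv : (m : 𝓞 K) ∉ v.asIdeal)
    {𝔐 : Ideal v.localAbsIntegers} (h𝔐 : 𝔐 ∈ v.localPrimesAbove)
    (ψ : contOneCocycles (torsionRepAt W (v.adicCompletion K) (m : ℤ)))
    (hψ : locClass (W.torsionGaloisModule (m : ℤ)) (v.adicCompletion K) ψ ∈
      W.kummerLocalConditionAt (m : ℤ) (v.adicCompletion K))
    (hψI : ∀ i ∈ 𝔐.inertia (absoluteGaloisGroup (v.adicCompletion K)), ψ.1 i = 0) :
    ∃ (κ : contOneCocycles (torsionRepAt W (v.adicCompletion K) ((m * m : ℕ) : ℤ)))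
      (T : Subgroup (absoluteGaloisGroup (v.adicCompletion K))),
      locClass (W.torsionGaloisModule ((m * m : ℕ) : ℤ)) (v.adicCompletion K) κ ∈
          W.kummerLocalConditionAt ((m * m : ℕ) : ℤ) (v.adicCompletion K) ∧
        (∀ σ, mulK W m m (κ.1 σ) = ψ.1 σ) ∧
        IsOpen (T : Set (absoluteGaloisGroup (v.adicCompletion K))) ∧
        𝔐.inertia (absoluteGaloisGroup (v.adicCompletion K)) ≤ T ∧
        ∀ σ : absoluteGaloisGroup (v.adicCompletion K), ∀ t ∈ T, κ.1 (σ * t) = κ.1 σ := by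
  haveI : CharZero (v.adicCompletion K) :=
    charZero_of_injective_algebraMap (algebraMap K (v.adicCompletion K)).injective
  have hm : (m : ℤ) ≠ 0 := Int.natCast_ne_zero.mpr (NeZero.ne m)
  have hmm : ((m * m : ℕ) : ℤ) ≠ 0 := Int.natCast_ne_zero.mpr (NeZero.ne (m * m))
  obtain ⟨Q, hQ, rfl⟩ := exists_localKummerCocycle_eq W (v.adicCompletion K) hm ψ hψ
  -- `I` fixes `Q`
  have hQI : ∀ i ∈ 𝔐.inertia (absoluteGaloisGroup (v.adicCompletion K)), i • Q = Q := fun i hi => by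
    have h := W.pointsMap_localKummerCocycle_apply (m : ℤ) hm Q hQ i
    rw [hψI i hi, ZeroMemClass.coe_zero, map_zero] at h
    exact (sub_eq_zero.mp h.symm)
  -- divide: `Q = m Q₁`; `I` fixes `Q₁` by the reduction step
  obtain ⟨Q₁, hQ₁⟩ : ∃ Q₁ : localPoints W (v.adicCompletion K), (m : ℤ) • Q₁ = Q :=
    (W.baseChange (AlgebraicClosure (v.adicCompletion K))).zsmul_surjective_of_isAlgClosed hm Q
  have hmv' : (((m : ℤ) : 𝓞 K)) ∉ v.asIdeal := by rwa [Int.cast_natCast]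
  have hQ₁I : ∀ i ∈ 𝔐.inertia (absoluteGaloisGroup (v.adicCompletion K)), i • Q₁ = Q₁ := fun i hi =>
    W.smul_localPoints_eq_of_mem_inertia_holds v hv hmv' h𝔐 hi (by
      rw [zsmul_sub, ← smul_zsmul_localPoints, hQ₁, hQI i hi, sub_self])
  have hfix : ((m * m : ℕ) : ℤ) • Q₁ ∈
      MulAction.fixedPoints (absoluteGaloisGroup (v.adicCompletion K)) (localPoints W (v.adicCompletion K)) := by
    rw [Nat.cast_mul, mul_zsmul, hQ₁]
    exact hQ
  refine ⟨W.localKummerCocycle _ hmm Q₁ hfix,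
    MulAction.stabilizer (absoluteGaloisGroup (v.adicCompletion K)) Q₁,
    W.localKummerClass_mem_kummerLocalConditionAt _ hmm Q₁ hfix, fun σ => ?_,
    W.isOpen_stabilizer_localPoints (v.adicCompletion K) Q₁, fun i hi => hQ₁I i hi, fun σ t ht => ?_⟩
  · -- `[m] θ⁻¹(σ Q₁ - Q₁) = θ⁻¹(σ Q - Q)`
    have h := (W.torsionPointsEquiv_symm_zsmul (m : ℤ) (m : ℤ) (mul_ne_zero hm hm) hm
      ⟨σ • Q₁ - Q₁, smul_sub_mem_torsionBy_localPoints hfix σ⟩).symm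
    refine h.trans ?_
    change (W.torsionPointsEquiv (m : ℤ) (E := v.adicCompletion K) hm).symm _ =
      (W.torsionPointsEquiv (m : ℤ) (E := v.adicCompletion K) hm).symm ⟨σ • Q - Q, _⟩
    congr 1
    apply Subtype.ext
    change (m : ℤ) • (σ • Q₁ - Q₁) = σ • Q - Q
    rw [zsmul_sub, ← smul_zsmul_localPoints, hQ₁]
  · -- `κ_{Q₁}(σ t) = θ⁻¹(σ t Q₁ - Q₁) = θ⁻¹(σ Q₁ - Q₁)`
    change (W.torsionPointsEquiv ((m * m : ℕ) : ℤ) (E := v.adicCompletion K) hmm).symm _ =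
      (W.torsionPointsEquiv ((m * m : ℕ) : ℤ) (E := v.adicCompletion K) hmm).symm _
    congr 1
    apply Subtype.ext
    change (σ * t) • Q₁ - Q₁ = σ • Q₁ - Q₁
    rw [mul_smul, MulAction.mem_stabilizer_iff.mp ht]

end KummerLift

/-! ## 4. Vanishing of the local term at an unramified good place -/

section Local

variable {K : Type u} [Field K] [NumberField K] (W : WeierstrassCurve K) (m : ℕ) [NeZero m]
variable (e : geomTorsion W ((m * m : ℕ) : ℤ) → geomTorsion W ((m * m : ℕ) : ℤ) → AlgebraicClosure K)
  (hμ : ∀ S T, e S T ^ (m * m) = 1)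
  (hadd₁ : ∀ S₁ S₂ T, e (S₁ + S₂) T = e S₁ T * e S₂ T)
  (hadd₂ : ∀ S T₁ T₂, e S (T₁ + T₂) = e S T₁ * e S T₂)
  (hgal : ∀ (σ : absoluteGaloisGroup K) (S T : geomTorsion W ((m * m : ℕ) : ℤ)),
    σ • e S T = e (σ • S) (σ • T))

omit [NumberField K] [NeZero m] in
/-- `μ_{m²}(K̄)` is killed by `m²`. [folklore] -/
theorem nsmul_muCarrier_eq_zero (x : MuCarrier K (m * m)) : (m * m) • x = 0 := by
  apply (MuCarrier.toAdditive (K := K)).injective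
  rw [map_nsmul, map_zero]
  apply Additive.toMul.injective
  rw [toMul_nsmul, toMul_zero]
  exact Subtype.ext (by
    rw [SubmonoidClass.coe_pow, OneMemClass.coe_one]
    exact (mem_rootsOfUnity _ _).mp (MuCarrier.toAdditive x).toMul.2)

/-- **The local term vanishes at an unramified good place, local core.**  Let `v ∤ m` be a finite place of
good reduction, `𝔐 ∣ 𝓂_v` the prime of `\bar 𝓞_v`, `U ≤ Γ_K` a NORMAL subgroup such that `res(I_𝔐) ⊆ U`
(`res = absGaloisRestrict K K_v`) and `U` acts trivially on `μ_{m²}`, and let `Dl` be a local datum over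
`K_v` (`GeneralLocalData`) whose cochains `β_{1}, β', ε` are restrictions of global cochains `B₁, B', ε₀`
of `Γ_K` right-invariant under `U` (in each argument), with `[m] ∘ β₁` a cocycle of `𝓛_v^{(m)}` and
`[β'] ∈ 𝓛_v^{(m)}`.  Then its local term vanishes for EVERY additive `inv_v : H²(K_v, μ_{m²}) → ℤ/m²`:
replace the Kummer cocycle `κ` of `Dl` by an unramified lift `κ'`, right-invariant under an open
`T ⊇ I` (`exists_kummerLift_unramified`; the term is unchanged, `GeneralLocalData.term_eq_of_kummer`);
the new `2`-cocycle `z_v = desc(ι⁻¹(β₁ - κ'), β') - ε` is right-invariant in both arguments under the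
open subgroup `res⁻¹(U) ∩ T ⊇ I`, which acts trivially on `μ_{m²}`, so `[z_v] = 0`
(`twoCocycleClass_eq_zero_of_inertia_le`). [cite: MilneADT2006, Ch. I §6, proof of Prop. 6.9 (p. 79)] -/
theorem GeneralLocalData.term_eq_zero_of_unramified [W.IsElliptic] (halt : ∀ T, e T T = 1)
    (v : HeightOneSpectrum (𝓞 K)) (hv : v ∉ W.badPlaces (𝓞 K)) (hmv : (m : 𝓞 K) ∉ v.asIdeal)
    {𝔐 : Ideal v.localAbsIntegers} (h𝔐 : 𝔐 ∈ v.localPrimesAbove)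
    (U : Subgroup (absoluteGaloisGroup K)) [U.Normal] (hUopen : IsOpen (U : Set (absoluteGaloisGroup K)))
    (hIU : ∀ i ∈ 𝔐.inertia (absoluteGaloisGroup (v.adicCompletion K)),
      absGaloisRestrict K (v.adicCompletion K) i ∈ U)
    (hUμ : ∀ u ∈ U, ∀ x : MuCarrier K (m * m), mu K (m * m) u x = x)
    (B₁ : C(absoluteGaloisGroup K, geomTorsion W ((m * m : ℕ) : ℤ)))
    (hB₁ : ∀ γ, ∀ u ∈ U, B₁ (γ * u) = B₁ γ)
    (B' : C(absoluteGaloisGroup K, geomTorsion W (m : ℤ)))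
    (hB' : ∀ γ, ∀ u ∈ U, B' (γ * u) = B' γ)
    (ε₀ : C(absoluteGaloisGroup K × absoluteGaloisGroup K, MuCarrier K (m * m)))
    (hε₁ : ∀ γ δ, ∀ u ∈ U, ε₀ (γ * u, δ) = ε₀ (γ, δ))
    (hε₂ : ∀ γ δ, ∀ u ∈ U, ε₀ (γ, δ * u) = ε₀ (γ, δ))
    (Dl : GeneralLocalData W m (v.adicCompletion K) e hμ hadd₁ hadd₂ hgal)
    (hDβ₁ : ∀ σ, Dl.β₁ σ = B₁ (absGaloisRestrict K (v.adicCompletion K) σ))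
    (hDβ' : ∀ σ, Dl.β'.1 σ = B' (absGaloisRestrict K (v.adicCompletion K) σ))
    (hDε : ∀ σ τ, Dl.ε (σ, τ) = ε₀ (absGaloisRestrict K (v.adicCompletion K) σ, absGaloisRestrict K (v.adicCompletion K) τ))
    (ψ : contOneCocycles (torsionRepAt W (v.adicCompletion K) (m : ℤ)))
    (hψ : ∀ σ, ψ.1 σ = mulK W m m (Dl.β₁ σ))
    (hψmem : locClass (W.torsionGaloisModule (m : ℤ)) (v.adicCompletion K) ψ ∈
      W.kummerLocalConditionAt (m : ℤ) (v.adicCompletion K))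
    (hβ'mem : locClass (W.torsionGaloisModule (m : ℤ)) (v.adicCompletion K) Dl.β' ∈
      W.kummerLocalConditionAt (m : ℤ) (v.adicCompletion K))
    (invE : galoisCohomology (GaloisRep.restrictField (v.adicCompletion K) (mu K (m * m))) 2 →+ ZMod (m * m)) :
    Dl.term invE = 0 := by
  haveI : CharZero (v.adicCompletion K) :=
    charZero_of_injective_algebraMap (algebraMap K (v.adicCompletion K)).injective
  -- the restricted cochain `ψ = [m] ∘ β₁` vanishes on `I` (it is right-`U`-invariant and a cocycle)
  have hψI : ∀ i ∈ 𝔐.inertia (absoluteGaloisGroup (v.adicCompletion K)), ψ.1 i = 0 := fun i hi => by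
    have h1 : ψ.1 (1 * i) = ψ.1 1 := by
      rw [hψ, hψ, hDβ₁, hDβ₁, map_mul (absGaloisRestrict K (v.adicCompletion K)),
        map_one (absGaloisRestrict K (v.adicCompletion K)), hB₁ _ _ (hIU i hi)]
    rw [one_mul, contOneCocycles.apply_one] at h1
    exact h1
  -- an unramified Kummer lift `κ'`, right-invariant under the open `T ⊇ I`
  obtain ⟨κ', T, hκ'mem, hκ'ψ, hTopen, hIT, hκ'T⟩ :=
    exists_kummerLift_unramified W m v hv hmv h𝔐 ψ hψmem hψI
  -- the modified datum and the invariance of the term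
  let D₂ : GeneralLocalData W m (v.adicCompletion K) e hμ hadd₁ hadd₂ hgal :=
    { Dl with κ := κ', κ_mem := hκ'mem, mulK_κ := fun σ => by rw [hκ'ψ, hψ] }
  have hterm : Dl.term invE = D₂.term invE :=
    GeneralLocalData.term_eq_of_kummer halt invE (D := Dl) (D₂ := D₂) rfl rfl rfl hβ'mem
  rw [hterm, GeneralLocalData.term]
  -- the open subgroup `S = res⁻¹(U) ∩ T ⊇ I` of `Γ_{K_v}`
  set r := absGaloisRestrict K (v.adicCompletion K) with hr
  set S : Subgroup (absoluteGaloisGroup (v.adicCompletion K)) :=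
    U.comap (r : absoluteGaloisGroup (v.adicCompletion K) →* absoluteGaloisGroup K) ⊓ T with hS
  have hSopen : IsOpen (S : Set (absoluteGaloisGroup (v.adicCompletion K))) := by
    rw [hS, Subgroup.coe_inf, Subgroup.coe_comap]
    exact (hUopen.preimage r.continuous).inter hTopen
  have hIS : 𝔐.inertia (absoluteGaloisGroup (v.adicCompletion K)) ≤ S := fun i hi =>
    ⟨Subgroup.mem_comap.mpr (hIU i hi), hIT hi⟩
  have hSU : ∀ s ∈ S, r s ∈ U := fun s hs => Subgroup.mem_comap.mp hs.1
  have hST : ∀ s ∈ S, s ∈ T := fun s hs => hs.2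
  have hSX : ∀ s ∈ S, ∀ x : (muRepAt (K := K) m (v.adicCompletion K)),
      (muRepAt (K := K) m (v.adicCompletion K)).ρ s x = x := fun s hs x => by
    rw [muRepAt_ρ_apply]
    exact hUμ _ (hSU s hs) x
  -- middle invariance of `B'` from normality of `U`
  have hB'mid : ∀ γ δ, ∀ u ∈ U, B' (γ * u * δ) = B' (γ * δ) := fun γ δ u hu => by
    have h : γ * u * δ = γ * δ * (δ⁻¹ * u * δ) := by group
    rw [h, hB' _ _ (Subgroup.Normal.conj_mem' inferInstance u hu δ)]
  have hz₁ : ∀ σ τ : absoluteGaloisGroup (v.adicCompletion K), ∀ s ∈ S,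
      D₂.cocycle.1 (σ * s, τ) = D₂.cocycle.1 (σ, τ) := fun σ τ s hs => by
    rw [GeneralLocalData.cocycle_apply, GeneralLocalData.cocycle_apply]
    change descendHom W m m e hμ hadd₁ hadd₂ (levelDown W m (Dl.β₁ (σ * s) - κ'.1 (σ * s)))
        (Dl.β'.1 (σ * s * τ) - Dl.β'.1 (σ * s)) - Dl.ε (σ * s, τ) =
      descendHom W m m e hμ hadd₁ hadd₂ (levelDown W m (Dl.β₁ σ - κ'.1 σ)) (Dl.β'.1 (σ * τ) - Dl.β'.1 σ) - Dl.ε (σ, τ)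
    rw [hDβ₁, hDβ₁, hDβ', hDβ', hDβ', hDβ', hDε, hDε, hκ'T σ s (hST s hs)]
    simp only [map_mul r]
    rw [hB₁ _ _ (hSU s hs), hB'mid _ _ _ (hSU s hs), hB' _ _ (hSU s hs), hε₁ _ _ _ (hSU s hs)]
  have hz₂ : ∀ σ τ : absoluteGaloisGroup (v.adicCompletion K), ∀ s ∈ S,
      D₂.cocycle.1 (σ, τ * s) = D₂.cocycle.1 (σ, τ) := fun σ τ s hs => by
    rw [GeneralLocalData.cocycle_apply, GeneralLocalData.cocycle_apply]
    change descendHom W m m e hμ hadd₁ hadd₂ (levelDown W m (Dl.β₁ σ - κ'.1 σ))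
        (Dl.β'.1 (σ * (τ * s)) - Dl.β'.1 σ) - Dl.ε (σ, τ * s) =
      descendHom W m m e hμ hadd₁ hadd₂ (levelDown W m (Dl.β₁ σ - κ'.1 σ)) (Dl.β'.1 (σ * τ) - Dl.β'.1 σ) - Dl.ε (σ, τ)
    rw [hDβ', hDβ', hDβ', hDε, hDε]
    simp only [map_mul r]
    rw [← mul_assoc, hB' _ _ (hSU s hs), hε₂ _ _ _ (hSU s hs)]
  have hz : locClass₂ (mu K (m * m)) (v.adicCompletion K) D₂.cocycle = 0 :=
    twoCocycleClass_eq_zero_of_inertia_le v h𝔐 (muRepAt (K := K) m (v.adicCompletion K))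
      (NeZero.ne (m * m)) (nsmul_muCarrier_eq_zero m) S hSopen hIS hSX D₂.cocycle hz₁ hz₂
  rw [hz, map_zero]

end Local

/-! ## 5. Finite support of the local terms of a general-case datum -/

section Global

variable {K : Type u} [Field K] [NumberField K] (W : WeierstrassCurve K) (m : ℕ) [NeZero m]
variable (e : geomTorsion W ((m * m : ℕ) : ℤ) → geomTorsion W ((m * m : ℕ) : ℤ) → AlgebraicClosure K)
  (hμ : ∀ S T, e S T ^ (m * m) = 1)
  (hadd₁ : ∀ S₁ S₂ T, e (S₁ + S₂) T = e S₁ T * e S₂ T)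
  (hadd₂ : ∀ S T₁ T₂, e S (T₁ + T₂) = e S T₁ * e S T₂)
  (hgal : ∀ (σ : absoluteGaloisGroup K) (S T : geomTorsion W ((m * m : ℕ) : ℤ)),
    σ • e S T = e (σ • S) (σ • T))

namespace GeneralCaseData

variable {W m e hμ hadd₁ hadd₂ hgal}
variable (D : GeneralCaseData W m e hμ hadd₁ hadd₂ hgal)

/-- **One open normal subgroup under which all the global cochains of a datum are invariant**: there is
an open normal `U = Gal(K̄/E) ≤ Γ_K` (`E/K` finite Galois) such that `β₁`, `β'` and `ε` (in each argument)
are right-invariant under `U`, `U` acts trivially on `μ_{m²}`, and the local inertia groups restrict into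
`U` at all but finitely many finite places (uniform local constancy of the finitely many continuous
cochains with discrete values on the compact group `Γ_K`, the Krull topology, and
`exists_openNormalSubgroup_subset`).  This is the tree's form of Milne's "the cochains are
`G_S`-cochains" (inflated from `Gal(E/K)`, `E` unramified outside `S`).
[cite: MilneADT2006, Ch. I §6, proof of Prop. 6.9 (p. 79) and Lemma 4.8] -/
theorem exists_openNormalSubgroup :
    ∃ U : Subgroup (absoluteGaloisGroup K), U.Normal ∧ IsOpen (U : Set (absoluteGaloisGroup K)) ∧
      (∀ γ, ∀ u ∈ U, D.β₁ (γ * u) = D.β₁ γ) ∧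
      (∀ γ, ∀ u ∈ U, D.β'.1 (γ * u) = D.β'.1 γ) ∧
      (∀ γ δ, ∀ u ∈ U, D.ε (γ * u, δ) = D.ε (γ, δ)) ∧
      (∀ γ δ, ∀ u ∈ U, D.ε (γ, δ * u) = D.ε (γ, δ)) ∧
      (∀ u ∈ U, ∀ x : MuCarrier K (m * m), mu K (m * m) u x = x) ∧
      ∀ᶠ v : HeightOneSpectrum (𝓞 K) in Filter.cofinite, ∀ 𝔐 ∈ v.localPrimesAbove,
        ∀ σ ∈ 𝔐.inertia (absoluteGaloisGroup (v.adicCompletion K)),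
          absGaloisRestrict K (v.adicCompletion K) σ ∈ U := by
  haveI : Finite (MuCarrier K (m * m)) := finite_muCarrier (F := K) (m * m)
  -- five neighbourhoods of `1`
  obtain ⟨V₁, hV₁, h₁⟩ := exists_nhds_one_forall_eq (fun γ u => D.β₁ (γ * u))
    (D.β₁.continuous.comp continuous_mul)
  obtain ⟨V₂, hV₂, h₂⟩ := exists_nhds_one_forall_eq (fun γ u => D.β'.1 (γ * u))
    (D.β'.1.continuous.comp continuous_mul)
  obtain ⟨V₃, hV₃, h₃⟩ := exists_nhds_one_forall_eq
    (fun (p : absoluteGaloisGroup K × absoluteGaloisGroup K) u => D.ε (p.1 * u, p.2))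
    (D.ε.continuous.comp (((continuous_fst.comp continuous_fst).mul continuous_snd).prodMk
      (continuous_snd.comp continuous_fst)))
  obtain ⟨V₄, hV₄, h₄⟩ := exists_nhds_one_forall_eq
    (fun (p : absoluteGaloisGroup K × absoluteGaloisGroup K) u => D.ε (p.1, p.2 * u))
    (D.ε.continuous.comp ((continuous_fst.comp continuous_fst).prodMk
      ((continuous_snd.comp continuous_fst).mul continuous_snd)))
  obtain ⟨V₅, hV₅, h₅⟩ := exists_nhds_one_forall_eq (fun (x : MuCarrier K (m * m)) u => mu K (m * m) u x)
    ((mu K (m * m)).continuous_smul.comp continuous_swap)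
  obtain ⟨U, hUn, hUopen, hUV, hev⟩ := exists_openNormalSubgroup_subset
    (Filter.inter_mem (Filter.inter_mem (Filter.inter_mem (Filter.inter_mem hV₁ hV₂) hV₃) hV₄) hV₅)
  refine ⟨U, hUn, hUopen, fun γ u hu => ?_, fun γ u hu => ?_, fun γ δ u hu => ?_, fun γ δ u hu => ?_,
    fun u hu x => ?_, hev⟩
  · have h := h₁ γ u (hUV hu).1.1.1.1
    simp only [mul_one] at h
    exact h
  · have h := h₂ γ u (hUV hu).1.1.1.2
    simp only [mul_one] at h
    exact h
  · have h := h₃ (γ, δ) u (hUV hu).1.1.2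
    simp only [mul_one] at h
    exact h
  · have h := h₄ (γ, δ) u (hUV hu).1.2
    simp only [mul_one] at h
    exact h
  · have h := h₅ x u (hUV hu).2
    simp only [map_one] at h
    exact h

/-- **The local terms of a general-case datum of the Cassels–Tate pairing have finite support**: for
every datum `D` and every family `inv` of additive maps `H²(K_v, μ_{m²}) → ℤ/m²` there is a finite set
of places outside which `t_v = inv_v [z_v] = 0` (module docstring, steps 1–5).  This is the hypothesis
`hfin` of `CasselsTateLevelAssembly.isLevelPairing_ctLevelPairing`, i.e. Milne's remark that the sum
defining `⟨a, a'⟩` is a finite sum `∑_{v ∈ S}` because all cochains are `G_S`-cochains.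
[cite: MilneADT2006, Ch. I §6, proof of Prop. 6.9 (p. 79)] -/
theorem exists_finset_forall_localTerm_eq_zero [W.IsElliptic] (halt : ∀ T, e T T = 1)
    (inv : LocalInvariants K (m * m)) :
    ∃ S : Finset (Place K), ∀ v ∉ S, D.localTerm inv v = 0 := by
  obtain ⟨U, hUn, hUopen, hβ₁, hβ', hε₁, hε₂, hμU, hev⟩ := D.exists_openNormalSubgroup
  haveI := hUn
  -- the finitely many exceptional finite places
  have h1 : Set.Finite {v : HeightOneSpectrum (𝓞 K) | ¬ ∀ 𝔐 ∈ v.localPrimesAbove,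
      ∀ σ ∈ 𝔐.inertia (absoluteGaloisGroup (v.adicCompletion K)),
        absGaloisRestrict K (v.adicCompletion K) σ ∈ U} :=
    Filter.eventually_cofinite.mp hev
  have h2 : (W.badPlaces (𝓞 K)).Finite := W.finite_badPlaces_holds (𝓞 K)
  have h3 : Set.Finite {v : HeightOneSpectrum (𝓞 K) | (m : 𝓞 K) ∈ v.asIdeal} := by
    have hm : Ideal.span {(m : 𝓞 K)} ≠ ⊥ := by
      rw [Ne, Ideal.span_singleton_eq_bot]
      exact Nat.cast_ne_zero.mpr (NeZero.ne m)
    exact (Ideal.finite_factors hm).subset fun v hv => Ideal.dvd_span_singleton.mpr hv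
  refine ⟨(Finset.univ : Finset (InfinitePlace K)).map ⟨Sum.inl, Sum.inl_injective⟩ ∪
    (h1.toFinset ∪ h2.toFinset ∪ h3.toFinset).map ⟨Sum.inr, Sum.inr_injective⟩, fun v hv => ?_⟩
  rcases v with w | v
  · exact absurd (Finset.mem_union_left _ (Finset.mem_map_of_mem _ (Finset.mem_univ w))) hv
  · have hv' : v ∉ h1.toFinset ∪ h2.toFinset ∪ h3.toFinset := fun h =>
      hv (Finset.mem_union_right _ (Finset.mem_map_of_mem _ h))
    simp only [Finset.mem_union, Set.Finite.mem_toFinset, Set.mem_setOf_eq, not_or, not_not] at hv'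
    obtain ⟨⟨hI, hgood⟩, hmv⟩ := hv'
    obtain ⟨𝔐, h𝔐⟩ := v.localPrimesAbove_nonempty
    -- specialise the local core to the datum `D.localData (Sum.inr v)` over `K_v = Place.Completion (Sum.inr v)`
    have hcore := GeneralLocalData.term_eq_zero_of_unramified W m e hμ hadd₁ hadd₂ hgal halt v hgood hmv h𝔐
      U hUopen (hI 𝔐 h𝔐) hμU D.β₁ hβ₁ D.β'.1 hβ' D.ε hε₁ hε₂
    exact hcore (D.localData (Sum.inr v)) (fun σ => rfl) (fun σ => rfl) (fun σ τ => rfl)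
      (resOne (W.torsionGaloisModule (m : ℤ)) (Place.Completion (Sum.inr v)) D.β)
      (fun σ => (D.mulK_β₁ _).symm) (D.locClass_resOne_β_mem (Sum.inr v)) (D.locClass_β'_mem (Sum.inr v))
      (inv (Sum.inr v))

end GeneralCaseData

/-! ## 6. The level-`m` assembly without the finite-support hypothesis -/

/-- **`hfin` discharged**: every general-case datum has finitely supported local terms (for any family
`inv`). [cite: MilneADT2006, Ch. I §6, proof of Prop. 6.9 (p. 79)] -/
theorem localTerm_finite_support [W.IsElliptic] (halt : ∀ T, e T T = 1) (inv : LocalInvariants K (m * m)) :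
    ∀ D : GeneralCaseData W m e hμ hadd₁ hadd₂ hgal, ∃ S : Finset (Place K), ∀ v ∉ S, D.localTerm inv v = 0 :=
  fun D => D.exists_finset_forall_localTerm_eq_zero halt inv

variable (inv : LocalInvariants K (m * m)) (halt : ∀ T, e T T = 1) (hPT' : inv.SumInvLocalizationEqZero)
  (hH3 : ∀ c : galoisCohomology (mu K (m * m)) 3,
    (∀ v : Place K, galoisCohomology.localization (mu K (m * m)) v 3 c = 0) → c = 0)

/-- **The level-`m` Cassels–Tate pairing is a level pairing, finite support discharged**: the tree's
`isLevelPairing_ctLevelPairing` with `hfin := localTerm_finite_support`.  Remaining inputs: `halt`,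
`hPT'` (reciprocity for `H²(K, μ_{m²})`), `hH3` (`Ш³(K, μ_{m²}) = 0`), `hPTc` (Poitou–Tate for
`Ш²(K, E[m])`), `h615` (Lemma 6.15 for all `S ⊇ S₀`) and the alternation `hct_alt` (odd `m`: the tree's
`ctGeneralFun_self_eq_zero_of_odd`). [cite: MilneADT2006, Ch. I §6, Thm. 6.13(a)] -/
theorem isLevelPairing_ctLevelPairing_of_inputs [W.IsElliptic]
    (hPTc : ∀ f : contTwoCocycles (W.torsionGaloisModule (m : ℤ)).toTopRep,
      (∀ g : contOneCocycles (W.torsionGaloisModule (m : ℤ)).toTopRep,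
        (∀ v : Place K, locClass (W.torsionGaloisModule (m : ℤ)) (Place.Completion v)
          (resOne (W.torsionGaloisModule (m : ℤ)) (Place.Completion v) g) = 0) →
        ∃ (C : PTChoice W m e hμ hadd₁ hadd₂ hgal f g) (S : Finset (Place K)),
          (∀ v ∉ S, C.localTerm inv v = 0) ∧ ∑ v ∈ S, C.localTerm inv v = 0) →
      twoCocycleClass _ f = 0)
    (S₀ : Finset (Place K))
    (h615 : ∀ S : Finset (Place K), S₀ ⊆ S → ∀ x : LocalClasses W m S,
      (∀ b' ∈ selmerGroup W (m : ℤ), sumPairing W m e hμ hadd₁ hadd₂ hgal inv S x (locS W m S b') = 0) →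
        ∃ b₀ ∈ kummerOutside W m S, ∀ v : S,
          x v - locS W m S b₀ v ∈ W.kummerLocalConditionAt (m : ℤ) (Place.Completion (v : Place K)))
    (hct_alt : ∀ a ∈ W.sha, (m : ℤ) • a = 0 → ctGeneralFun W m e hμ hadd₁ hadd₂ hgal inv a a = 0) :
    IsLevelPairing m (ctLevelPairing W m e hμ hadd₁ hadd₂ hgal inv halt hPT' hH3
      (localTerm_finite_support W m e hμ hadd₁ hadd₂ hgal halt inv)) :=
  isLevelPairing_ctLevelPairing W m e hμ hadd₁ hadd₂ hgal inv halt hPT' hH3 _ hPTc S₀ h615 hct_alt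

include halt hPT' hH3 in
/-- **Existence form** (the hypothesis of `WeierstrassCurve.exists_casselsTate_pairing_of_levelwise` at
`m = p^k`), finite support discharged. [cite: MilneADT2006, Ch. I §6, Thm. 6.13(a)]
[cite: SilvermanAEC2009, Thm. X.4.14] -/
theorem exists_isLevelPairing_of_inputs [W.IsElliptic]
    (hPTc : ∀ f : contTwoCocycles (W.torsionGaloisModule (m : ℤ)).toTopRep,
      (∀ g : contOneCocycles (W.torsionGaloisModule (m : ℤ)).toTopRep,
        (∀ v : Place K, locClass (W.torsionGaloisModule (m : ℤ)) (Place.Completion v)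
          (resOne (W.torsionGaloisModule (m : ℤ)) (Place.Completion v) g) = 0) →
        ∃ (C : PTChoice W m e hμ hadd₁ hadd₂ hgal f g) (S : Finset (Place K)),
          (∀ v ∉ S, C.localTerm inv v = 0) ∧ ∑ v ∈ S, C.localTerm inv v = 0) →
      twoCocycleClass _ f = 0)
    (S₀ : Finset (Place K))
    (h615 : ∀ S : Finset (Place K), S₀ ⊆ S → ∀ x : LocalClasses W m S,
      (∀ b' ∈ selmerGroup W (m : ℤ), sumPairing W m e hμ hadd₁ hadd₂ hgal inv S x (locS W m S b') = 0) →
        ∃ b₀ ∈ kummerOutside W m S, ∀ v : S,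
          x v - locS W m S b₀ v ∈ W.kummerLocalConditionAt (m : ℤ) (Place.Completion (v : Place K)))
    (hct_alt : ∀ a ∈ W.sha, (m : ℤ) • a = 0 → ctGeneralFun W m e hμ hadd₁ hadd₂ hgal inv a a = 0) :
    ∃ B : AddSubgroup.torsionBy W.sha m →+ AddSubgroup.torsionBy W.sha m →+ AddCircle (1 : ℚ), IsLevelPairing m B :=
  ⟨_, isLevelPairing_ctLevelPairing_of_inputs W m e hμ hadd₁ hadd₂ hgal inv halt hPT' hH3 hPTc S₀ h615 hct_alt⟩

end Global

/-! ## 7. The Cassels–Tate fact from its remaining inputs, level by level -/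

section Fact

variable {K : Type u} [Field K] [NumberField K]

/-- **`WeierstrassCurve.exists_casselsTate_pairing` from its remaining inputs.**  By the tree's reduction to
prime-power levels (`WeierstrassCurve.exists_casselsTate_pairing_of_levelwise`), the Weil pairing at level
`q²` (`exists_weilPairing_holds`, Silverman III.8.1) and `exists_isLevelPairing_of_inputs`, the
Cassels–Tate fact over the number field `K` follows as soon as, for every elliptic curve `E/K`, every prime
power `q` and every NONDEGENERATE alternating Galois-equivariant pairing `e : E[q²] × E[q²] → μ_{q²}` (a unit
multiple of the Weil pairing), there is a
family `inv` of local invariant maps `H²(K_v, μ_{q²}) → ℤ/q²` satisfying: the reciprocity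
`inv.SumInvLocalizationEqZero` (Milne I 4.10(b)/A.7), `Ш³(K, μ_{q²}) = 0` (I 4.10(c)), the Poitou–Tate
vanishing criterion for `Ш²(K, E[q])` in cochain form (I 4.10(a)), the conclusion of Lemma 6.15 for all
finite `S ⊇ S₀` (I 6.15, from I 4.10 exactness, injectivity of the `inv_v` and I 2.8), and the alternation
of the general-case pairing on `Ш[q]` (Cassels 1962; proved in the tree for odd `q`,
`ctGeneralFun_self_eq_zero_of_odd`).  This theorem is the COMPLETE list of what separates the tree from
the fact. [cite: MilneADT2006, Ch. I §6, Thm. 6.13(a) and Prop. 6.9] [cite: SilvermanAEC2009, Thm. X.4.14] -/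
theorem exists_casselsTate_pairing_of_inputs
    (h : ∀ (W : WeierstrassCurve K) [W.IsElliptic] (q : ℕ) [NeZero q]
      (e : geomTorsion W ((q * q : ℕ) : ℤ) → geomTorsion W ((q * q : ℕ) : ℤ) → AlgebraicClosure K)
      (hμ : ∀ S T, e S T ^ (q * q) = 1)
      (hadd₁ : ∀ S₁ S₂ T, e (S₁ + S₂) T = e S₁ T * e S₂ T)
      (hadd₂ : ∀ S T₁ T₂, e S (T₁ + T₂) = e S T₁ * e S T₂)
      (hgal : ∀ (σ : absoluteGaloisGroup K) (S T : geomTorsion W ((q * q : ℕ) : ℤ)),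
        σ • e S T = e (σ • S) (σ • T)),
      (∀ T, e T T = 1) → (∀ T, (∀ S, e S T = 1) → T = 0) → (∃ p k : ℕ, p.Prime ∧ 0 < k ∧ q = p ^ k) →
      ∃ (inv : LocalInvariants K (q * q)) (_ : inv.SumInvLocalizationEqZero)
        (_ : ∀ c : galoisCohomology (mu K (q * q)) 3,
          (∀ v : Place K, galoisCohomology.localization (mu K (q * q)) v 3 c = 0) → c = 0)
        (S₀ : Finset (Place K)),
        (∀ f : contTwoCocycles (W.torsionGaloisModule (q : ℤ)).toTopRep,
          (∀ g : contOneCocycles (W.torsionGaloisModule (q : ℤ)).toTopRep,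
            (∀ v : Place K, locClass (W.torsionGaloisModule (q : ℤ)) (Place.Completion v)
              (resOne (W.torsionGaloisModule (q : ℤ)) (Place.Completion v) g) = 0) →
            ∃ (C : PTChoice W q e hμ hadd₁ hadd₂ hgal f g) (S : Finset (Place K)),
              (∀ v ∉ S, C.localTerm inv v = 0) ∧ ∑ v ∈ S, C.localTerm inv v = 0) →
          twoCocycleClass _ f = 0) ∧
        (∀ S : Finset (Place K), S₀ ⊆ S → ∀ x : LocalClasses W q S,
          (∀ b' ∈ selmerGroup W (q : ℤ), sumPairing W q e hμ hadd₁ hadd₂ hgal inv S x (locS W q S b') = 0) →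
            ∃ b₀ ∈ kummerOutside W q S, ∀ v : S,
              x v - locS W q S b₀ v ∈ W.kummerLocalConditionAt (q : ℤ) (Place.Completion (v : Place K))) ∧
        (∀ a ∈ W.sha, (q : ℤ) • a = 0 → ctGeneralFun W q e hμ hadd₁ hadd₂ hgal inv a a = 0)) :
    exists_casselsTate_pairing (K := K) := by
  refine exists_casselsTate_pairing_of_levelwise fun W _ p k hp hk => ?_
  haveI : NeZero (p ^ k) := ⟨pow_ne_zero k hp.ne_zero⟩
  -- the Weil pairing at level `q² = p^k · p^k`
  have h2 : 2 ≤ p ^ k * p ^ k :=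
    le_trans hp.two_le (le_trans (Nat.le_self_pow hk.ne' p) (Nat.le_mul_of_pos_right _ (NeZero.pos (p ^ k))))
  have hq : ((p ^ k * p ^ k : ℕ) : K) ≠ 0 := Nat.cast_ne_zero.mpr (NeZero.ne (p ^ k * p ^ k))
  obtain ⟨e, hμ, hadd₁, hadd₂, halt, hnd, hgal⟩ := exists_weilPairing_holds W (p ^ k * p ^ k) h2 hq
  obtain ⟨inv, hPT', hH3, S₀, hPTc, h615, hct⟩ := h W (p ^ k) e hμ hadd₁ hadd₂ hgal halt hnd ⟨p, k, hp, hk, rfl⟩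
  exact exists_isLevelPairing_of_inputs W (p ^ k) e hμ hadd₁ hadd₂ hgal inv halt hPT' hH3 hPTc S₀ h615 hct

end Fact

end Literature.NumberTheory.EllipticCurves

end
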